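import Literature.Probability.LatticeModels.PolygonWordLevelGraph
import HarnessLib

/-!
# The word of a lattice polygon, II: the one-row step lemmas and the invariant

Second of four files proving `Literature.Probability.LatticeModels.RowTransferExactness`.
Given the level graph of row `y - 1` represented by a two-star row state (file I), one letter of
the word — restrict to the common columns, insert the new ones, vertical layer, horizontal layer,
wire the discrete-arc columns to the stars — produces a state representing the level graph of row
`y`:

* `vOpen D S y`, `hOpen D S y`: the open vertical / horizontal bonds of row `y` read from the label
  set `D`, as column sets;
* `represents_vert` (restriction + insertion + vertical layer = stage 1, via the vertical
  projection `vProj`), `represents_horiz` (stage 2), `represents_wire` (stages 3, 4);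
* `detRow`, `detState`: the deterministic word state of a bond configuration, and the invariant
  `represents_detState`; the read-out `starsJoined_detState_iff`: the two stars are joined in the
  final state iff an open path inside `V` joins `V ∩ W 0` to `V ∩ W 1`.

Sources as in file I (Cardy, arXiv:math-ph/0103018, §7.1; Bondesan–Jacobsen–Saleur,
arXiv:1207.7005, §5; Jacobsen–Zinn-Justin, arXiv:cond-mat/0111374, §4); folklore bookkeeping.
-/

noncomputable section

open Finset SimpleGraph
open scoped Classical

namespace Literature.Probability.LatticeModels

namespace PolygonWord

/-! ### The step lemmas of one row -/

section Steps

/-- A site is the vector of its two coordinates. [folklore] -/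
private theorem site_eq_vec (u : Site 2) : u = ![u 0, u 1] := by
  ext i; fin_cases i <;> simp


variable (D : Set (Site 2 × Fin 2)) (V : Finset (Site 2)) (W : Fin 2 → Set (Site 2))

/-- The open vertical bonds below row `y`, as a set of columns of `S`. [folklore] -/
def vOpen (S : Finset ℤ) (y : ℤ) : Finset S :=
  univ.filter fun x : S => (((![(x : ℤ), y] : Site 2)), (0 : Fin 2)) ∈ D

/-- The open horizontal bonds inside row `y`, as a set of left columns of `S` (a subset of
`hEdges S`). [folklore] -/
def hOpen (S : Finset ℤ) (y : ℤ) : Finset S :=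
  univ.filter fun x : S => (x : ℤ) + 1 ∈ S ∧ (((![(x : ℤ), y] : Site 2)), (1 : Fin 2)) ∈ D

/-- `hOpen ⊆ hEdges`. [folklore] -/
theorem hOpen_subset_hEdges (S : Finset ℤ) (y : ℤ) : hOpen D S y ⊆ hEdges S := by
  intro x hx
  simp only [hOpen, mem_filter, mem_univ, true_and] at hx
  simpa [hEdges] using hx.1

variable {D V W}

/-- New edges given by an oriented relation whose instances join embedded `θ`-related points
satisfy the hypothesis of the extension lemma. [folklore] -/
theorem new_of_fromRel {β : Type*} {G : SimpleGraph Node} {r : Node → Node → Prop}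
    {emb : β → Node} {θ : Setoid β}
    (h : ∀ p q, r p q → ∃ a c, emb a = p ∧ emb c = q ∧ θ a c) (p q : Node)
    (hpq : (G ⊔ SimpleGraph.fromRel r).Adj p q) :
    G.Adj p q ∨ ∃ a c, emb a = p ∧ emb c = q ∧ θ a c := by
  rw [SimpleGraph.sup_adj, SimpleGraph.fromRel_adj] at hpq
  rcases hpq with hG | ⟨-, hr | hr⟩
  · exact Or.inl hG
  · exact Or.inr (h p q hr)
  · obtain ⟨a, c, ha, hc, hac⟩ := h q p hr
    exact Or.inr ⟨c, a, hc, ha, Setoid.symm' θ hac⟩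

/-- **Horizontal layer.** If `ρ` represents stage 1 of row `y` over the columns `S` of row `y`,
then `horizRel₂ (hOpen D S y) ρ` represents stage 2. [folklore] -/
theorem represents_horiz {y : ℤ} {S : Finset ℤ} (hS : ∀ x, x ∈ S ↔ (![x, y] : Site 2) ∈ V)
    {ρ : Setoid (RowPoint₂ S)} (hρ : Represents ρ (stage1 D V W y) (rowEmb S y)) :
    Represents (horizRel₂ (hOpen D S y) ρ) (stage2 D V W y) (rowEmb S y) := by
  refine represents_sup (rowEmb S y) hρ (le_horizRel₂ _ _) ?_ (new_of_fromRel ?_)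
  · refine horizRel₂_le (le_reachSetoid_of_represents _ hρ (stage1_le_stage2 D V W y)) ?_
    intro x hx h1
    rw [reachSetoid_rel]
    refine Adj.reachable (le_sup_right (a := stage1 D V W y) (fromRel_adj_of_rel ?_ ?_))
    · simp [rowEmb]
    · simp only [hOpen, mem_filter, mem_univ, true_and] at hx
      refine ⟨(hS x).1 x.2, (hS _).1 h1, ?_, hx.2, by simp⟩
      exact (vec_add_unitVec_zero _ _).symm
  · rintro (u | i) (v | j) h <;> try exact h.elim
    obtain ⟨hu, hv, rfl, hd, huy⟩ := h
    have hu' : u = ![u 0, y] := by rw [← huy]; exact site_eq_vec u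
    have hx : u 0 ∈ S := (hS _).2 (hu' ▸ hu)
    have hx1 : u 0 + 1 ∈ S := by
      refine (hS _).2 ?_
      rw [← vec_add_unitVec_zero, ← hu']
      exact hv
    refine ⟨Sum.inl ⟨u 0, hx⟩, Sum.inl ⟨u 0 + 1, hx1⟩, ?_, ?_, ?_⟩
    · simp only [rowEmb]
      rw [← hu']
    · simp only [rowEmb]
      rw [← vec_add_unitVec_zero, ← hu']
    · refine horizRel₂_rel_of_mem _ _ ?_ hx1
      simp only [hOpen, mem_filter, mem_univ, true_and]
      exact ⟨hx1, by rw [← hu']; exact hd⟩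

/-- **Wiring.** If `ρ` represents `G` over the columns `S` of row `y`, then wiring the columns of
`W i` to `⋆ i` represents `G` plus the star edges of row `y` towards `⋆ i`. [folklore] -/
theorem represents_wire {y : ℤ} {S : Finset ℤ} (hS : ∀ x, x ∈ S ↔ (![x, y] : Site 2) ∈ V)
    {G : SimpleGraph Node} {ρ : Setoid (RowPoint₂ S)} (hρ : Represents ρ G (rowEmb S y))
    (i : Fin 2) :
    Represents (wireRel (rowWires (W i) S y) i ρ) (G ⊔ SimpleGraph.fromRel (starNew V W y i))
      (rowEmb S y) := by
  refine represents_sup (rowEmb S y) hρ (le_wireRel _ _ _) ?_ (new_of_fromRel ?_)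
  · refine wireRel_le (le_reachSetoid_of_represents _ hρ le_sup_left) ?_
    intro x hx
    rw [reachSetoid_rel]
    refine Adj.reachable (le_sup_right (a := G) (fromRel_adj_of_rel ?_ ?_))
    · simp [rowEmb, RowPoint₂.star]
    · rw [mem_rowWires] at hx
      exact (⟨rfl, (hS x).1 x.2, by simp, hx⟩ : starNew V W y i (Sum.inl _) (Sum.inr i))
  · rintro (u | i') (v | j) h <;> try exact h.elim
    obtain ⟨rfl, hu, huy, hw⟩ := h
    have hu' : u = ![u 0, y] := by rw [← huy]; exact site_eq_vec u
    have hx : u 0 ∈ S := (hS _).2 (hu' ▸ hu)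
    refine ⟨Sum.inl ⟨u 0, hx⟩, Sum.inr j, ?_, rfl, ?_⟩
    · simp only [rowEmb]
      rw [← hu']
    · refine wire_joins _ _ ⟨ρ⟩ ?_
      rw [mem_rowWires, ← hu']
      exact hw

/-- The vertical projection of row `y`: slide a site of row `y` down its vertical bond when that
bond is open and both ends lie in `V`; fix everything else. [folklore] -/
def vProj (D : Set (Site 2 × Fin 2)) (V : Finset (Site 2)) (y : ℤ) : Node → Node
  | Sum.inl v => if v ∈ V ∧ v 1 = y ∧ v - unitVec 1 ∈ V ∧ (v, (0 : Fin 2)) ∈ D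
      then Sum.inl (v - unitVec 1) else Sum.inl v
  | Sum.inr i => Sum.inr i

/-- Sites of rows `> y` are isolated in the level graph at row `y`. [folklore] -/
theorem levelGraph_isolated {y : ℤ} {v : Site 2} (hv : y < v 1) (w : Node) :
    ¬ (levelGraph D V W y).Adj (Sum.inl v) w := by
  intro h
  obtain ⟨-, h | h⟩ := (SimpleGraph.fromRel_adj _ _ w).1 h
  · rcases w with u | i
    · exact absurd h.2.1 (by omega)
    · exact absurd h.2.1 (by omega)
  · rcases w with u | i
    · exact absurd h.2.2 (by omega)
    · exact h.elim

/-- Stage 1 reachability is reachability of the vertical projections in the previous level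
graph. [folklore] -/
theorem stage1_reachable_iff (y : ℤ) (p q : Node) :
    (stage1 D V W y).Reachable p q ↔
      (levelGraph D V W (y - 1)).Reachable (vProj D V y p) (vProj D V y q) := by
  refine reachable_iff_of_proj (levelGraph_pred_le_stage1 D V W y) (vProj D V y) ?_ ?_ p q
  · rintro (v | i)
    · simp only [vProj]
      split_ifs with h
      · refine Adj.reachable (le_sup_right (a := levelGraph D V W (y - 1)) ?_)
        refine (fromRel_adj_of_rel ?_ ?_).symm
        · simp only [ne_eq, Sum.inl.injEq]
          intro h'
          have := congrFun h' 1
          simp at this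
        · exact (⟨h.2.2.1, h.1, by simp, h.2.2.2, h.2.1⟩ : vertNew D V y (Sum.inl _) (Sum.inl v))
      · exact Reachable.refl _
    · exact Reachable.refl _
  · intro p q hpq
    rw [stage1, SimpleGraph.sup_adj] at hpq
    rcases hpq with h | h
    · -- an old edge: both ends are fixed by the projection
      right
      have fix : ∀ {p q : Node}, (levelGraph D V W (y - 1)).Adj p q → vProj D V y p = p := by
        rintro (v | i) q h
        · simp only [vProj]
          rw [if_neg]
          rintro ⟨-, hy, -⟩
          exact levelGraph_isolated (y := y - 1) (by omega) q h
        · rfl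
      rwa [fix h, fix h.symm]
    · -- a new vertical bond is collapsed
      left
      obtain ⟨-, h | h⟩ := (SimpleGraph.fromRel_adj _ p q).1 h
      · rcases p with u | i <;> rcases q with v | j <;> try exact h.elim
        obtain ⟨hu, hv, rfl, hd, hy⟩ := h
        simp only [vProj]
        rw [if_neg, if_pos ⟨hv, hy, by simpa using hu, hd⟩]
        · simp
        · rintro ⟨-, hy', -⟩
          rw [add_unitVec_one_apply_one] at hy
          omega
      · rcases p with u | i <;> rcases q with v | j <;> try exact h.elim
        obtain ⟨hv, hu, rfl, hd, hy⟩ := h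
        simp only [vProj]
        rw [if_pos ⟨hu, hy, by simpa using hv, hd⟩, if_neg]
        · simp
        · rintro ⟨-, hy', -⟩
          rw [add_unitVec_one_apply_one] at hy
          omega

/-- **Restriction, insertion and vertical layer.** If `ρ₀` represents the level graph at row
`y - 1` over the columns `S₀` of row `y - 1`, then restricting to `S₀ ∩ S`, inserting into the
columns `S` of row `y` and applying the vertical layer with the open vertical bonds represents
stage 1 of row `y`. [folklore] -/
theorem represents_vert {y : ℤ} {S₀ S : Finset ℤ} (hS₀ : ∀ x, x ∈ S₀ ↔ (![x, y - 1] : Site 2) ∈ V)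
    (hS : ∀ x, x ∈ S ↔ (![x, y] : Site 2) ∈ V) {ρ₀ : Setoid (RowPoint₂ S₀)}
    (hρ₀ : Represents ρ₀ (levelGraph D V W (y - 1)) (rowEmb S₀ (y - 1))) :
    Represents (vertRel₂ (vOpen D S y)
      (insertRel₂ (Finset.inter_subset_right : S₀ ∩ S ⊆ S)
        (restrictRel₂ (Finset.inter_subset_left : S₀ ∩ S ⊆ S₀) ρ₀)))
      (stage1 D V W y) (rowEmb S y) := by
  -- abbreviations
  set h₁ : S₀ ∩ S ⊆ S := Finset.inter_subset_right
  set h₀ : S₀ ∩ S ⊆ S₀ := Finset.inter_subset_left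
  set O := vOpen D S y
  -- `lowerRel a a₀`: the point `a` of row `y` hangs on the point `a₀` of row `y - 1`
  let lowerRel : RowPoint₂ S → RowPoint₂ S₀ → Prop := fun a a₀ =>
    IsUp₂ O a ∧ ∃ a' : RowPoint₂ (S₀ ∩ S), RowPoint₂.incl h₁ a' = a ∧ RowPoint₂.incl h₀ a' = a₀
  -- (1) the new relation in terms of `lowerRel`
  have step1 : ∀ a c, vertRel₂ O (insertRel₂ h₁ (restrictRel₂ h₀ ρ₀)) a c ↔
      a = c ∨ ∃ a₀ c₀, lowerRel a a₀ ∧ lowerRel c c₀ ∧ ρ₀ a₀ c₀ := by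
    intro a c
    rw [vertRel₂_apply]
    constructor
    · rintro (h | ⟨ha, hc, h | ⟨a', c', rfl, rfl, h⟩⟩)
      · exact Or.inl h
      · exact Or.inl h
      · exact Or.inr ⟨_, _, ⟨ha, a', rfl, rfl⟩, ⟨hc, c', rfl, rfl⟩, h⟩
    · rintro (h | ⟨a₀, c₀, ⟨ha, a', rfl, rfl⟩, ⟨hc, c', rfl, rfl⟩, h⟩)
      · exact Or.inl h
      · exact Or.inr ⟨ha, hc, Or.inr ⟨a', c', rfl, rfl, h⟩⟩
  -- (2) a hanging point projects to the point it hangs on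
  have step2 : ∀ a a₀, lowerRel a a₀ → vProj D V y (rowEmb S y a) = rowEmb S₀ (y - 1) a₀ := by
    rintro a a₀ ⟨ha, a', rfl, rfl⟩
    rcases a' with t | i
    · have ht₀ : (t : ℤ) ∈ S₀ := h₀ t.2
      have ht : (t : ℤ) ∈ S := h₁ t.2
      simp only [RowPoint₂.incl, rowEmb, vProj]
      rw [if_pos]
      · rw [vec_sub_unitVec_one]
      · refine ⟨(hS _).1 ht, by simp, ?_, ?_⟩
        · rw [vec_sub_unitVec_one]
          exact (hS₀ _).1 ht₀
        · simpa [O, vOpen, IsUp₂, RowPoint₂.incl] using ha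
    · rfl
  -- (3) a point hanging on nothing is a site of row `y`, fixed and isolated
  have step3 : ∀ a, (¬ ∃ a₀, lowerRel a a₀) →
      ∃ x : S, a = Sum.inl x ∧ vProj D V y (rowEmb S y a) = rowEmb S y a := by
    rintro (x | i) hno
    · refine ⟨x, rfl, ?_⟩
      simp only [rowEmb, vProj]
      rw [if_neg]
      rintro ⟨-, -, hV, hD⟩
      rw [vec_sub_unitVec_one] at hV
      have hx₀ : (x : ℤ) ∈ S₀ := (hS₀ _).2 hV
      have hxO : x ∈ O := by simpa [O, vOpen] using hD
      exact hno ⟨Sum.inl ⟨x, hx₀⟩, hxO, Sum.inl ⟨x, Finset.mem_inter.2 ⟨hx₀, x.2⟩⟩, rfl, rfl⟩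
    · exact absurd ⟨Sum.inr i, trivial, Sum.inr i, rfl, rfl⟩ hno
  have iso : ∀ x : S, ∀ w, ¬ (levelGraph D V W (y - 1)).Adj (rowEmb S y (Sum.inl x)) w :=
    fun x w => levelGraph_isolated (by simp) w
  have ne : ∀ (x : S) (c₀ : RowPoint₂ S₀), rowEmb S y (Sum.inl x) ≠ rowEmb S₀ (y - 1) c₀ := by
    rintro x (x' | i) h
    · simp only [rowEmb, Sum.inl.injEq, vec_eq_vec_iff] at h
      omega
    · simp [rowEmb] at h
  -- (4) assemble
  intro a c
  rw [step1, stage1_reachable_iff]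
  constructor
  · rintro (rfl | ⟨a₀, c₀, ha, hc, h⟩)
    · exact Reachable.refl _
    · rw [step2 a a₀ ha, step2 c c₀ hc]
      exact (hρ₀ a₀ c₀).1 h
  · intro h
    by_cases ha : ∃ a₀, lowerRel a a₀ <;> by_cases hc : ∃ c₀, lowerRel c c₀
    · obtain ⟨a₀, ha⟩ := ha
      obtain ⟨c₀, hc⟩ := hc
      rw [step2 a a₀ ha, step2 c c₀ hc] at h
      exact Or.inr ⟨a₀, c₀, ha, hc, (hρ₀ a₀ c₀).2 h⟩
    · obtain ⟨a₀, ha⟩ := ha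
      obtain ⟨x, rfl, hfix⟩ := step3 c hc
      rw [step2 a a₀ ha, hfix] at h
      exact absurd ((reachable_iff_eq_of_isolated (iso x) _).1 h.symm) (ne x a₀)
    · obtain ⟨c₀, hc⟩ := hc
      obtain ⟨x, rfl, hfix⟩ := step3 a ha
      rw [step2 c c₀ hc, hfix] at h
      exact absurd ((reachable_iff_eq_of_isolated (iso x) _).1 h) (ne x c₀)
    · obtain ⟨x, rfl, hfix⟩ := step3 _ ha
      obtain ⟨x', rfl, hfix'⟩ := step3 _ hc
      rw [hfix, hfix'] at h
      exact Or.inl (rowEmb_injective S y ((reachable_iff_eq_of_isolated (iso x) _).1 h))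

end Steps

/-! ### The deterministic word and its invariant -/

section DetState

/-- **One deterministic row letter**: restrict to the common columns, insert the new ones, apply
the row step with the open vertical / horizontal bonds of row `y` read from `D`, then wire the
columns of `W 0`, `W 1` to the two stars. [folklore] -/
def detRow (D : Set (Site 2 × Fin 2)) (W : Fin 2 → Set (Site 2)) (S₀ S : Finset ℤ) (y : ℤ)
    (π : RowState₂ S₀) : RowState₂ S :=
  wire (rowWires (W 1) S y) 1 (wire (rowWires (W 0) S y) 0
    (rowStep₂ (vOpen D S y) (hOpen D S y)
      (insertState₂ (Finset.inter_subset_right : S₀ ∩ S ⊆ S)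
        (restrictState₂ (Finset.inter_subset_left : S₀ ∩ S ⊆ S₀) π))))

/-- **The deterministic word state** after the rows `b + 1, …, b + n` of `V`, for the bond
configuration `D`. [folklore] -/
def detState (D : Set (Site 2 × Fin 2)) (V : Finset (Site 2)) (W : Fin 2 → Set (Site 2)) (b : ℤ) :
    (n : ℕ) → RowState₂ (rowCols V (b + n))
  | 0 => RowState₂.free _
  | n + 1 => detRow D W (rowCols V (b + n)) (rowCols V (b + ((n + 1 : ℕ) : ℤ))) (b + ((n + 1 : ℕ) : ℤ))
      (detState D V W b n)

variable {D : Set (Site 2 × Fin 2)} {V : Finset (Site 2)} {W : Fin 2 → Set (Site 2)}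

/-- One row: if `π` represents the level graph at row `y - 1`, then `detRow … π` represents the
level graph at row `y`. [folklore] -/
theorem represents_detRow {y : ℤ} {S₀ S : Finset ℤ} (hS₀ : ∀ x, x ∈ S₀ ↔ (![x, y - 1] : Site 2) ∈ V)
    (hS : ∀ x, x ∈ S ↔ (![x, y] : Site 2) ∈ V) {π : RowState₂ S₀}
    (hπ : Represents π.rel (levelGraph D V W (y - 1)) (rowEmb S₀ (y - 1))) :
    Represents (detRow D W S₀ S y π).rel (levelGraph D V W y) (rowEmb S y) := by
  have h1 := represents_vert hS₀ hS hπ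
  have h2 := represents_horiz hS h1
  have h3 := represents_wire (W := W) hS h2 0
  have h4 := represents_wire (W := W) hS h3 1
  exact represents_levelGraph_of_stage4 D V W y h4

/-- Stars are isolated in the level graph below the lowest row of `V`. [folklore] -/
theorem levelGraph_star_isolated {y : ℤ} (hb : ∀ v ∈ V, y < v 1) (i : Fin 2) (w : Node) :
    ¬ (levelGraph D V W y).Adj (Sum.inr i) w := by
  intro h
  obtain ⟨-, h | h⟩ := (SimpleGraph.fromRel_adj _ _ w).1 h
  · exact h.elim
  · rcases w with u | j
    · exact absurd h.2.1 (by have := hb u h.1; omega)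
    · exact h.elim

/-- **The invariant.** The deterministic word state after `n` rows represents the level graph at
row `b + n` (for a base row `b` below every row of `V`). [folklore] -/
theorem represents_detState (b : ℤ) (hb : ∀ v ∈ V, b < v 1) :
    ∀ n : ℕ, Represents (detState D V W b n).rel (levelGraph D V W (b + n))
      (rowEmb (rowCols V (b + n)) (b + n))
  | 0 => by
    have hb' : ∀ v ∈ V, b + ((0 : ℕ) : ℤ) < v 1 := by simpa using hb
    rintro (x | i) c
    · exact absurd (hb' _ (mem_rowCols.1 x.2)) (by simp)
    · change Sum.inr i = c ↔ (levelGraph D V W (b + ((0 : ℕ) : ℤ))).Reachable (Sum.inr i)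
        (rowEmb _ (b + ((0 : ℕ) : ℤ)) c)
      rw [reachable_iff_eq_of_isolated (levelGraph_star_isolated hb' i)]
      exact ⟨fun h => by rw [← h]; rfl, fun h => rowEmb_injective _ _ h⟩
  | n + 1 => by
    have e : b + ((n + 1 : ℕ) : ℤ) - 1 = b + (n : ℤ) := by push_cast; ring
    have ih := represents_detState b hb n
    have ih' : Represents (detState D V W b n).rel (levelGraph D V W (b + ((n + 1 : ℕ) : ℤ) - 1))
        (rowEmb (rowCols V (b + n)) (b + ((n + 1 : ℕ) : ℤ) - 1)) := by
      rw [e]; exact ih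
    have hS₀ : ∀ x, x ∈ rowCols V (b + n) ↔ (![x, b + ((n + 1 : ℕ) : ℤ) - 1] : Site 2) ∈ V := by
      rw [e]; exact fun x => mem_rowCols
    exact represents_detRow hS₀ (fun x => mem_rowCols) ih'

/-- Open paths inside `V` give paths in the level graph above the top row. [folklore] -/
theorem levelGraph_reachable_of_openInduced {y : ℤ} (hy : ∀ v ∈ V, v 1 ≤ y) {u v : Site 2}
    (h : (openInduced D V).Reachable u v) : (levelGraph D V W y).Reachable (Sum.inl u) (Sum.inl v) := by
  rw [reachable_iff_reflTransGen] at h ⊢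
  refine Relation.ReflTransGen.lift (Sum.inl : Site 2 → Node) (fun a c hac => ?_) _ _ h
  obtain ⟨hne, hr⟩ := (SimpleGraph.fromRel_adj _ a c).1 hac
  refine (SimpleGraph.fromRel_adj _ _ _).2 ⟨by simpa using hne, ?_⟩
  rcases hr with hr | hr
  · exact Or.inl ⟨hr, hy a hr.1, hy c hr.2.1⟩
  · exact Or.inr ⟨hr, hy c hr.1, hy a hr.2.1⟩

/-- **Read-out.** Above the top row, the stars are joined in the level graph iff some vertex of
`V ∩ W 0` is joined to some vertex of `V ∩ W 1` by an open path inside `V`. [folklore] -/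
theorem levelGraph_stars_reachable_iff {y : ℤ} (hy : ∀ v ∈ V, v 1 ≤ y) :
    (levelGraph D V W y).Reachable (Sum.inr 0) (Sum.inr 1) ↔
      ∃ u, u ∈ V ∧ u ∈ W 0 ∧ ∃ v, v ∈ V ∧ v ∈ W 1 ∧ (openInduced D V).Reachable u v := by
  constructor
  · intro h
    by_contra hno
    -- the set of nodes reachable from `⋆ 0` without using `⋆ 1`
    let C : Set Node := {p | p = Sum.inr 0 ∨
      ∃ w, p = Sum.inl w ∧ ∃ u, u ∈ V ∧ u ∈ W 0 ∧ (openInduced D V).Reachable u w}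
    have hC : ∀ p q, p ∈ C → (levelGraph D V W y).Adj p q → q ∈ C := by
      intro p q hp hpq
      obtain ⟨hne, hr⟩ := (SimpleGraph.fromRel_adj _ p q).1 hpq
      rcases hp with rfl | ⟨w, rfl, u, hu, hu0, huw⟩
      · rcases hr with hr | hr
        · exact hr.elim
        · rcases q with v | j
          · exact Or.inr ⟨v, rfl, v, hr.1, hr.2.2, Reachable.refl _⟩
          · exact hr.elim
      · rcases q with v | j
        · have hadj : (openInduced D V).Adj w v := by
            refine (SimpleGraph.fromRel_adj _ _ _).2 ⟨by simpa using hne, ?_⟩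
            rcases hr with hr | hr
            · exact Or.inl hr.1
            · exact Or.inr hr.1
          exact Or.inr ⟨v, rfl, u, hu, hu0, huw.trans hadj.reachable⟩
        · rcases hr with hr | hr
          · fin_cases j
            · exact Or.inl rfl
            · exact absurd ⟨u, hu, hu0, w, hr.1, hr.2.2, huw⟩ hno
          · exact hr.elim
    have h1 : (Sum.inr 1 : Node) ∈ C := mem_of_reachable_of_closed hC (Or.inl rfl) h
    rcases h1 with h1 | ⟨w, h1, -⟩
    · exact absurd h1 (by simp)
    · exact absurd h1 (by simp)
  · rintro ⟨u, hu, hu0, v, hv, hv1, huv⟩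
    have h0 : (levelGraph D V W y).Adj (Sum.inl u) (Sum.inr 0) :=
      fromRel_adj_of_rel (r := levelRel D V W y) (p := Sum.inl u) (q := Sum.inr 0) (by simp)
        ⟨hu, hy u hu, hu0⟩
    have h1 : (levelGraph D V W y).Adj (Sum.inl v) (Sum.inr 1) :=
      fromRel_adj_of_rel (r := levelRel D V W y) (p := Sum.inl v) (q := Sum.inr 1) (by simp)
        ⟨hv, hy v hv, hv1⟩
    exact (h0.symm.reachable.trans (levelGraph_reachable_of_openInduced hy huv)).trans h1.reachable

/-- **Deterministic exactness.** For a base row `b` below `V` and `n` rows covering `V`, the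
stars are joined in the deterministic word state iff the bond configuration `D` contains an open
path inside `V` from `V ∩ W 0` to `V ∩ W 1`. [folklore] -/
theorem starsJoined_detState_iff (b : ℤ) (n : ℕ) (hb : ∀ v ∈ V, b < v 1 ∧ v 1 ≤ b + n) :
    (detState D V W b n).StarsJoined ↔
      ∃ u, u ∈ V ∧ u ∈ W 0 ∧ ∃ v, v ∈ V ∧ v ∈ W 1 ∧ (openInduced D V).Reachable u v := by
  have h := represents_detState (D := D) (W := W) b (fun v hv => (hb v hv).1) n
    (RowPoint₂.star _ 0) (RowPoint₂.star _ 1)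
  rw [← levelGraph_stars_reachable_iff (fun v hv => (hb v hv).2)]
  exact h

end DetState

end PolygonWord

end Literature.Probability.LatticeModels

end
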